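import Literature.NumberTheory.Transcendental.ChudnovskyAnalytic
import HarnessLib

/-!
# Tubbs 1990, Theorem 4 (periods form) — the auxiliary function and the value formula

Topic `Literature/NumberTheory/Transcendental` (trunk T-TRANSCEND). First file of the discharge of
the named fact `Literature.NumberTheory.Transcendental.Tubbs1990_thm4_periods`
(`TubbsPeriodsIndependence.lean`; R. Tubbs, *Algebraic groups and small transcendence degree,
II*, J. Number Theory 35 (1990), Thm 4 p. 112 and Remark p. 114 = G. V. Chudnovsky,
*Contributions to the theory of transcendental numbers* (1984), Ch. 7, Thm 4.1 (i), p. 318):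
for every lattice basis `(ω₁, ω₂)` and `c ≠ 0`,
`trdeg_ℚ ℚ(g₂, g₃, ω₁, ω₂, c, e^{cω₁}, e^{cω₂}) ≥ 2`.

The proof is Gel'fond's method in one variable with Chudnovsky's auxiliary function
(loc. cit. p. 318: "`F₁(z) = P(z, ℘(z), e^{φz})`", vanishing to high order at the points
`n₁ω₁ + n₂ω₂`). We use the translate by the half-period `ω₁/2` and the adapted basis
`(z - ω₁/2)ⁱ e^{jc(z - ω₁/2)} (℘(z) - e₁)ᵏ`, `e₁ = ℘(ω₁/2)`, so that at the points
`z_n = ω₁/2 + n₁ω₁ + n₂ω₂` (`n ∈ ℕ²`) the three functions take the values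
`n₁ω₁ + n₂ω₂`, `(e^{cω₁})^{n₁}(e^{cω₂})^{n₂}`, `0`, and `℘'(z_n) = 0`.

This file is the analogue of `ChudnovskyAnalytic.lean`, Part II, for this auxiliary function:

* the points `zpt L n`, the index set `Lam La L0 L1 = Fin La × Fin L0 × Fin L1` of the
  coefficients and the auxiliary function `F L c p`;
* the derivation `D` of `R[X₀, X₁, X₂]` with `D X₀ = 1`, `D X₁ = X₂`,
  `D X₂ = 6X₁² + 12e X₁ + (6e² - b)` — the algebraic form of `d/dz` on
  `ℂ[z - ω₁/2, ℘ - e₁, ℘']` (`℘'' = 6℘² - g₂/2`, `e = e₁`, `b = g₂/2`) — and the *twisted*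
  operators `E_μ = D + μ` which describe `d/dz` on `e^{μ(z - ω₁/2)} · Q(z - ω₁/2, ℘ - e₁, ℘')`;
* the chain rule and its iterates (`iteratedDeriv_F`);
* the formal side over `ℤ[X₀, X₁, X₂; a₀, …, a₆]` (`a = (ω₁, ω₂, c, e^{cω₁}, e^{cω₂}, e₁, g₂/2)`),
  the integer polynomials `V t n l ∈ ℤ[a₀, …, a₆]` and the **value formula**
  `F^{(t)}(z_n) = ∑_l p_l · φx (V t n l)` (`iteratedDeriv_F_zpt`).

## References

* R. Tubbs, J. Number Theory 35 (1990), Thm 4 (p. 112), Remark p. 114, §5. [Tubbs1990]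
* G. V. Chudnovsky, *Contributions to the theory of transcendental numbers* (1984), Ch. 7,
  Thm 4.1 (i), p. 318. [Chudnovsky1984]
-/

noncomputable section

open Complex Metric Filter Topology Finset
open scoped PeriodPair

namespace Literature.NumberTheory.Transcendental.TubbsPeriods

open Literature.NumberTheory.Transcendental.Chudnovsky (e₁ s s_notMem add_notMem weierstrassP_s
  derivWeierstrassP_s)

variable (L : PeriodPair) (c : ℂ)

/-! ### The points `z_n = ω₁/2 + n₁ω₁ + n₂ω₂` -/

/-- The lattice vector `n₁ω₁ + n₂ω₂` of a pair `n = (n₁, n₂) ∈ ℕ²`. [folklore] -/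
def lvec (n : ℕ × ℕ) : ℂ := (n.1 : ℂ) * L.ω₁ + (n.2 : ℂ) * L.ω₂

/-- The points `z_n = ω₁/2 + n₁ω₁ + n₂ω₂` at which the auxiliary function is made to vanish
(Chudnovsky 1984, Ch. 7, p. 318: "`(F(n₁ω₁ + n₂ω₂))^{(k)} = 0`", translated by the half-period
`ω₁/2`). [cite: Chudnovsky1984, Ch. 7 Thm 4.1 p. 318] -/
def zpt (n : ℕ × ℕ) : ℂ := L.ω₁ / 2 + lvec L n

/-- `n₁ω₁ + n₂ω₂ ∈ Λ`. [folklore] -/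
lemma lvec_mem (n : ℕ × ℕ) : lvec L n ∈ L.lattice := by
  unfold lvec
  refine add_mem ?_ ?_
  · have := zsmul_mem L.ω₁_mem_lattice (n.1 : ℤ)
    simpa [zsmul_eq_mul] using this
  · have := zsmul_mem L.ω₂_mem_lattice (n.2 : ℤ)
    simpa [zsmul_eq_mul] using this

/-- `z_n = s_{n₂} + n₁ω₁` in the notation of `ChudnovskyAnalytic.lean`. [folklore] -/
lemma zpt_eq_s_add (n : ℕ × ℕ) : zpt L n = s L n.2 + ((n.1 : ℤ) : ℂ) * L.ω₁ := by
  unfold zpt lvec s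
  push_cast
  ring

/-- `z_n ∉ Λ`. [folklore] -/
lemma zpt_notMem (n : ℕ × ℕ) : zpt L n ∉ L.lattice :=
  add_notMem L L.ω₁_div_two_notMem_lattice (lvec_mem L n)

/-- `z_n - ω₁/2 = n₁ω₁ + n₂ω₂`. [folklore] -/
@[simp] lemma zpt_sub (n : ℕ × ℕ) : zpt L n - L.ω₁ / 2 = lvec L n := by
  unfold zpt; ring

/-- `℘(z_n) = e₁`. [folklore] -/
lemma weierstrassP_zpt (n : ℕ × ℕ) : ℘[L] (zpt L n) = e₁ L := by
  unfold zpt e₁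
  simpa using L.weierstrassP_add_coe (L.ω₁ / 2) ⟨lvec L n, lvec_mem L n⟩

/-- `℘'(z_n) = 0`. [folklore] -/
lemma derivWeierstrassP_zpt (n : ℕ × ℕ) : ℘'[L] (zpt L n) = 0 := by
  unfold zpt
  have h := L.derivWeierstrassP_add_coe (L.ω₁ / 2) ⟨lvec L n, lvec_mem L n⟩
  simp only at h
  rw [h, Chudnovsky.derivWeierstrassP_ω₁_div_two]

/-- `℘(ω₁/2 + n₁ω₁ + n₂ω₂ + h) = ℘(ω₁/2 + h)`. [folklore] -/
lemma weierstrassP_zpt_add (n : ℕ × ℕ) (h : ℂ) : ℘[L] (zpt L n + h) = ℘[L] (L.ω₁ / 2 + h) := by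
  unfold zpt
  have := L.weierstrassP_add_coe (L.ω₁ / 2 + h) ⟨lvec L n, lvec_mem L n⟩
  simp only at this
  rw [← this]
  ring_nf

/-! ### The auxiliary function -/

/-- The index set of the coefficients `p (i, j, k)`, `i < La`, `j < L0`, `k < L1`. [folklore] -/
abbrev Lam (La L0 L1 : ℕ) : Type := Fin La × Fin L0 × Fin L1

variable {La L0 L1 : ℕ}

/-- **The auxiliary function**
`F_p(z) = ∑ p(i,j,k) (z - ω₁/2)ⁱ e^{jc(z - ω₁/2)} (℘(z) - e₁)ᵏ` — Chudnovsky's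
`F₁(z) = P(z, ℘(z), e^{φz})` written in the adapted basis at the half-period `ω₁/2`.
[cite: Chudnovsky1984, Ch. 7 Thm 4.1 p. 318] -/
def F (p : Lam La L0 L1 → ℂ) (z : ℂ) : ℂ :=
  ∑ l, p l * ((z - L.ω₁ / 2) ^ (l.1 : ℕ) * cexp ((l.2.1 : ℕ) * c * (z - L.ω₁ / 2)) *
    (℘[L] z - e₁ L) ^ (l.2.2 : ℕ))

/-! ### The derivation `D` and the twisted operators `E_μ` -/

section Derivation

open MvPolynomial

variable {R : Type*} [CommRing R]

/-- The values of `D` on the variables: `D X₀ = 1`, `D X₁ = X₂`,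
`D X₂ = 6X₁² + 12e X₁ + (6e² - b)` (`X₀ ↔ z - ω₁/2`, `X₁ ↔ ℘ - e₁`, `X₂ ↔ ℘'`; `e ↔ e₁`,
`b ↔ g₂/2`; `℘'' = 6℘² - g₂/2 = 6(℘-e₁)² + 12e₁(℘-e₁) + 6e₁² - g₂/2`). [folklore] -/
def tubDVal (e b : R) : Fin 3 → MvPolynomial (Fin 3) R :=
  ![1, X 2, 6 * X 1 ^ 2 + C (12 * e) * X 1 + C (6 * e ^ 2 - b)]

/-- The derivation `D = ∂₀ + X₂∂₁ + (6X₁² + 12eX₁ + 6e² - b)∂₂` of `R[X₀, X₁, X₂]`.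
[folklore] -/
def tubD (e b : R) : Derivation R (MvPolynomial (Fin 3) R) (MvPolynomial (Fin 3) R) :=
  MvPolynomial.mkDerivation R (tubDVal e b)

/-- `D X_i` is the prescribed value. [folklore] -/
@[simp] lemma tubD_X (e b : R) (i : Fin 3) : tubD e b (X i) = tubDVal e b i :=
  MvPolynomial.mkDerivation_X _ _ _

/-- `D (C r) = 0`. [folklore] -/
@[simp] lemma tubD_C (e b : R) (r : R) : tubD e b (C r) = 0 :=
  MvPolynomial.derivation_C _ _

/-- The twisted operator `E_μ = D + μ`, describing `d/dz` on `e^{μ(z-ω₁/2)} Q`: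
`(e^{μu} Q)' = e^{μu}(D Q + μ Q)`. [folklore] -/
def tubE (e b μ : R) : MvPolynomial (Fin 3) R →ₗ[R] MvPolynomial (Fin 3) R :=
  (tubD e b).toLinearMap + LinearMap.mulLeft R (C μ)

/-- Unfolding `E_μ`. [folklore] -/
lemma tubE_apply (e b μ : R) (Q : MvPolynomial (Fin 3) R) :
    tubE e b μ Q = tubD e b Q + C μ * Q := rfl

end Derivation

/-! ### The chain rule -/

open MvPolynomial

/-- The vector of functions `(z - ω₁/2, ℘ - e₁, ℘')` at `z`. [folklore] -/
def fv (z : ℂ) : Fin 3 → ℂ := ![z - L.ω₁ / 2, ℘[L] z - e₁ L, ℘'[L] z]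

/-- `fv 0 = z - ω₁/2`. [folklore] -/
@[simp] lemma fv_zero (z : ℂ) : fv L z 0 = z - L.ω₁ / 2 := rfl
/-- `fv 1 = ℘ - e₁`. [folklore] -/
@[simp] lemma fv_one (z : ℂ) : fv L z 1 = ℘[L] z - e₁ L := rfl
/-- `fv 2 = ℘'`. [folklore] -/
@[simp] lemma fv_two (z : ℂ) : fv L z 2 = ℘'[L] z := rfl

/-- `fv(z_n) = (n₁ω₁ + n₂ω₂, 0, 0)`. [folklore] -/
lemma fv_zpt (n : ℕ × ℕ) : fv L (zpt L n) = ![lvec L n, 0, 0] := by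
  ext i
  fin_cases i
  · simp
  · simp [weierstrassP_zpt]
  · simp [derivWeierstrassP_zpt]

/-- The derivation `D = D_{e₁, g₂/2}` over `ℂ`. [folklore] -/
abbrev Dℂ : Derivation ℂ (MvPolynomial (Fin 3) ℂ) (MvPolynomial (Fin 3) ℂ) :=
  tubD (e₁ L) (L.g₂ / 2)

/-- The twisted operator `E_μ` over `ℂ`. [folklore] -/
abbrev Eℂ (μ : ℂ) : MvPolynomial (Fin 3) ℂ →ₗ[ℂ] MvPolynomial (Fin 3) ℂ :=
  tubE (e₁ L) (L.g₂ / 2) μ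

/-- The variables satisfy the chain rule: `d/dz (fv z i) = (D X_i)(fv z)` off the lattice.
[folklore] -/
theorem hasDerivAt_fv {z : ℂ} (hz : z ∉ L.lattice) (i : Fin 3) :
    HasDerivAt (fun w => fv L w i) (eval (fv L z) (Dℂ L (X i))) z := by
  fin_cases i
  · simpa [tubDVal] using (hasDerivAt_id z).sub_const (L.ω₁ / 2)
  · simpa [tubDVal] using (L.hasDerivAt_weierstrassP hz).sub_const (e₁ L)
  · have hd : HasDerivAt ℘'[L] (deriv ℘'[L] z) z :=
      ((L.analyticOnNhd_derivWeierstrassP z hz).differentiableAt).hasDerivAt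
    rw [L.deriv_derivWeierstrassP hz] at hd
    have : (6 * ℘[L] z ^ 2 - L.g₂ / 2 : ℂ) =
        6 * (℘[L] z - e₁ L) ^ 2 + 12 * e₁ L * (℘[L] z - e₁ L) + (6 * e₁ L ^ 2 - L.g₂ / 2) := by
      ring
    rw [this] at hd
    simpa [tubDVal] using hd

/-- **Chain rule**: `d/dz Q(fv(z)) = (D Q)(fv(z))` for `z ∉ Λ`. [folklore] -/
theorem hasDerivAt_eval_fv (Q : MvPolynomial (Fin 3) ℂ) {z : ℂ} (hz : z ∉ L.lattice) :
    HasDerivAt (fun w => eval (fv L w) Q) (eval (fv L z) (Dℂ L Q)) z := by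
  induction Q using MvPolynomial.induction_on with
  | C r => simpa using hasDerivAt_const z r
  | add p q hp hq =>
    simp only [map_add]
    exact hp.add hq
  | mul_X p i hp =>
    have hi := hasDerivAt_fv L hz i
    have := hp.mul hi
    simp only [map_mul, eval_X]
    refine this.congr_deriv ?_
    rw [Derivation.leibniz]
    simp only [smul_eq_mul, map_add, map_mul, eval_X]
    ring

/-- **Twisted chain rule**: `d/dz [e^{μ(z-ω₁/2)} Q(fv(z))] = e^{μ(z-ω₁/2)} (E_μ Q)(fv(z))` for
`z ∉ Λ`. [folklore] -/
theorem hasDerivAt_exp_mul_eval_fv (μ : ℂ) (Q : MvPolynomial (Fin 3) ℂ) {z : ℂ}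
    (hz : z ∉ L.lattice) :
    HasDerivAt (fun w => cexp (μ * (w - L.ω₁ / 2)) * eval (fv L w) Q)
      (cexp (μ * (z - L.ω₁ / 2)) * eval (fv L z) (Eℂ L μ Q)) z := by
  have h1 : HasDerivAt (fun w => cexp (μ * (w - L.ω₁ / 2))) (cexp (μ * (z - L.ω₁ / 2)) * μ) z := by
    have : HasDerivAt (fun w => μ * (w - L.ω₁ / 2)) μ z := by
      simpa using ((hasDerivAt_id z).sub_const (L.ω₁ / 2)).const_mul μ
    exact this.cexp
  have h2 := hasDerivAt_eval_fv L Q hz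
  have := h1.mul h2
  refine this.congr_deriv ?_
  rw [tubE_apply, map_add, map_mul, eval_C]
  ring

/-- Iterated twisted chain rule:
`(d/dz)^t [e^{μ(z-ω₁/2)} Q(fv(z))] = e^{μ(z-ω₁/2)} (E_μ^t Q)(fv(z))` for `z ∉ Λ`. [folklore] -/
theorem iteratedDeriv_exp_mul_eval_fv (μ : ℂ) (t : ℕ) (Q : MvPolynomial (Fin 3) ℂ) {z : ℂ}
    (hz : z ∉ L.lattice) :
    iteratedDeriv t (fun w => cexp (μ * (w - L.ω₁ / 2)) * eval (fv L w) Q) z =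
      cexp (μ * (z - L.ω₁ / 2)) * eval (fv L z) (((Eℂ L μ) ^ t) Q) := by
  induction t generalizing z with
  | zero => simp
  | succ t ih =>
    rw [iteratedDeriv_succ, pow_succ', Module.End.mul_apply]
    have hev : iteratedDeriv t (fun w => cexp (μ * (w - L.ω₁ / 2)) * eval (fv L w) Q) =ᶠ[𝓝 z]
        fun w => cexp (μ * (w - L.ω₁ / 2)) * eval (fv L w) (((Eℂ L μ) ^ t) Q) := by
      filter_upwards [L.isClosed_lattice.isOpen_compl.mem_nhds hz] with w hw
      exact ih hw
    rw [hev.deriv_eq]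
    exact (hasDerivAt_exp_mul_eval_fv L μ _ hz).deriv

/-! ### The auxiliary function and its derivatives -/

/-- The monomial `X₀ⁱ X₁ᵏ`. [folklore] -/
abbrev mono (R : Type*) [CommSemiring R] (i k : ℕ) : MvPolynomial (Fin 3) R :=
  X 0 ^ i * X 1 ^ k

/-- The frequency `j·c` of the index `l = (i, j, k)`. [folklore] -/
def freq (l : Lam La L0 L1) : ℂ := (l.2.1 : ℕ) * c

/-- `F_p(z) = ∑ p_l e^{jc(z-ω₁/2)} (X₀ⁱX₁ᵏ)(fv(z))`. [folklore] -/
theorem F_eq_sum_eval (p : Lam La L0 L1 → ℂ) (z : ℂ) :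
    F L c p z = ∑ l, p l * (cexp (freq c l * (z - L.ω₁ / 2)) * eval (fv L z) (mono ℂ l.1 l.2.2)) := by
  unfold F freq
  refine Finset.sum_congr rfl fun l _ => ?_
  simp only [map_mul, map_pow, eval_X, fv_zero, fv_one]
  ring

/-- `F_p` is analytic off the lattice. [folklore] -/
theorem analyticAt_F (p : Lam La L0 L1 → ℂ) {z : ℂ} (hz : z ∉ L.lattice) :
    AnalyticAt ℂ (F L c p) z := by
  have h1 := L.analyticOnNhd_weierstrassP z hz
  unfold F
  refine Finset.analyticAt_fun_sum _ fun l _ => ?_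
  refine analyticAt_const.mul ((((analyticAt_id.sub analyticAt_const).pow _).mul ?_).mul
    ((h1.sub analyticAt_const).pow _))
  exact (analyticAt_const.mul (analyticAt_id.sub analyticAt_const)).cexp

/-- `F_p` is holomorphic off the lattice. [folklore] -/
theorem differentiableOn_F (p : Lam La L0 L1 → ℂ) :
    DifferentiableOn ℂ (F L c p) L.latticeᶜ :=
  fun _ hz => (analyticAt_F L c p hz).differentiableAt.differentiableWithinAt

/-- **The derivatives of `F_p` off the lattice**:
`F_p^{(t)}(z) = ∑ p_l e^{jc(z-ω₁/2)} (E_{jc}^t X₀ⁱX₁ᵏ)(fv(z))`. [folklore] -/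
theorem iteratedDeriv_F (p : Lam La L0 L1 → ℂ) (t : ℕ) {z : ℂ} (hz : z ∉ L.lattice) :
    iteratedDeriv t (F L c p) z =
      ∑ l, p l * (cexp (freq c l * (z - L.ω₁ / 2)) *
        eval (fv L z) (((Eℂ L (freq c l)) ^ t) (mono ℂ l.1 l.2.2))) := by
  induction t generalizing z with
  | zero => simpa using F_eq_sum_eval L c p z
  | succ t ih =>
    rw [iteratedDeriv_succ]
    have hev : iteratedDeriv t (F L c p) =ᶠ[𝓝 z] fun w => ∑ l, p l *
        (cexp (freq c l * (w - L.ω₁ / 2)) * eval (fv L w) (((Eℂ L (freq c l)) ^ t) (mono ℂ l.1 l.2.2))) := by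
      filter_upwards [L.isClosed_lattice.isOpen_compl.mem_nhds hz] with w hw
      exact ih hw
    rw [hev.deriv_eq]
    have hsum : HasDerivAt (fun w => ∑ l, p l *
        (cexp (freq c l * (w - L.ω₁ / 2)) * eval (fv L w) (((Eℂ L (freq c l)) ^ t) (mono ℂ l.1 l.2.2))))
        (∑ l, p l * (cexp (freq c l * (z - L.ω₁ / 2)) *
          eval (fv L z) (((Eℂ L (freq c l)) ^ (t + 1)) (mono ℂ l.1 l.2.2)))) z := by
      refine HasDerivAt.fun_sum fun l _ => ?_
      have h := (hasDerivAt_exp_mul_eval_fv L (freq c l) (((Eℂ L (freq c l)) ^ t) (mono ℂ l.1 l.2.2))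
        hz).const_mul (p l)
      refine h.congr_deriv ?_
      rw [pow_succ', Module.End.mul_apply]
    exact hsum.deriv

/-- `e^{jc(n₁ω₁ + n₂ω₂)} = (e^{cω₁})^{n₁ j} (e^{cω₂})^{n₂ j}`. [folklore] -/
lemma cexp_freq_lvec (l : Lam La L0 L1) (n : ℕ × ℕ) :
    cexp (freq c l * lvec L n) =
      cexp (c * L.ω₁) ^ (n.1 * (l.2.1 : ℕ)) * cexp (c * L.ω₂) ^ (n.2 * (l.2.1 : ℕ)) := by
  unfold freq lvec
  rw [← Complex.exp_nat_mul, ← Complex.exp_nat_mul, ← Complex.exp_add]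
  congr 1
  push_cast
  ring

/-- **The derivatives of `F_p` at the points `z_n`**:
`F_p^{(t)}(z_n) = ∑ p_l (e^{cω₁})^{n₁j}(e^{cω₂})^{n₂j} (E_{jc}^t X₀ⁱX₁ᵏ)(n₁ω₁+n₂ω₂, 0, 0)`.
[cite: Chudnovsky1984, Ch. 7 Thm 4.1 p. 318] -/
theorem iteratedDeriv_F_zpt_eq_sum (p : Lam La L0 L1 → ℂ) (t : ℕ) (n : ℕ × ℕ) :
    iteratedDeriv t (F L c p) (zpt L n) =
      ∑ l, p l * (cexp (c * L.ω₁) ^ (n.1 * (l.2.1 : ℕ)) * cexp (c * L.ω₂) ^ (n.2 * (l.2.1 : ℕ)) *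
        eval ![lvec L n, 0, 0] (((Eℂ L (freq c l)) ^ t) (mono ℂ l.1 l.2.2))) := by
  rw [iteratedDeriv_F L c p t (zpt_notMem L n), fv_zpt]
  refine Finset.sum_congr rfl fun l _ => ?_
  rw [zpt_sub, cexp_freq_lvec]

/-! ### The formal side: integer polynomials in `(X₀, X₁, X₂; a₀, …, a₆)` -/

/-- The coefficient ring `RA = ℤ[a₀, …, a₆]` of the formal computation
(`a = (ω₁, ω₂, c, e^{cω₁}, e^{cω₂}, e₁, g₂/2)`). [folklore] -/
abbrev RA : Type := MvPolynomial (Fin 7) ℤ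

/-- The flat formal ring `RX = ℤ[X₀, X₁, X₂; a₀, …, a₆]` (variables `Sum.inl i ↔ Xᵢ`,
`Sum.inr l ↔ a_l`). [folklore] -/
abbrev RX : Type := MvPolynomial (Fin 3 ⊕ Fin 7) ℤ

/-- The values of the formal derivation on the variables: `D X₀ = 1`, `D X₁ = X₂`,
`D X₂ = 6X₁² + 12a₅X₁ + 6a₅² - a₆`, `D a_l = 0`. [folklore] -/
def dval : Fin 3 ⊕ Fin 7 → RX :=
  Sum.elim ![1, X (Sum.inl 2),
    6 * X (Sum.inl 1) ^ 2 + 12 * X (Sum.inr 5) * X (Sum.inl 1) + 6 * X (Sum.inr 5) ^ 2 - X (Sum.inr 6)] 0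

/-- The formal derivation `D₀` of `ℤ[X; a]` (the `a_l` are constants). [folklore] -/
def D₀ : Derivation ℤ RX RX := MvPolynomial.mkDerivation ℤ dval

/-- `D₀ X_s = dval s`. [folklore] -/
@[simp] lemma D₀_X (s' : Fin 3 ⊕ Fin 7) : D₀ (X s') = dval s' :=
  MvPolynomial.mkDerivation_X _ _ _

/-- The formal twisted operator `E_j = D₀ + j·a₂` (`a₂ ↔ c`). [folklore] -/
def E₀ (j : ℕ) : RX →ₗ[ℤ] RX :=
  D₀.toLinearMap + LinearMap.mulLeft ℤ ((j : RX) * X (Sum.inr 2))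

/-- Unfolding `E_j`. [folklore] -/
lemma E₀_apply (j : ℕ) (Q : RX) : E₀ j Q = D₀ Q + (j : RX) * X (Sum.inr 2) * Q := rfl

/-- The substitution at the point `z_n`: `X₀ ↦ n₁a₀ + n₂a₁`, `X₁ ↦ 0`, `X₂ ↦ 0`, `a_l ↦ a_l`.
[folklore] -/
def sval (n : ℕ × ℕ) : Fin 3 ⊕ Fin 7 → RA :=
  Sum.elim ![(n.1 : RA) * X 0 + (n.2 : RA) * X 1, 0, 0] X

/-- **The formal values** `V t n (i,j,k) = a₃^{n₁j} a₄^{n₂j} · (E_j^t (X₀ⁱX₁ᵏ))(n₁a₀+n₂a₁, 0, 0; a)`: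
integer polynomials in `a₀, …, a₆` whose specialisations are the numbers `F_p^{(t)}(z_n)`
(for `p` the indicator of `l`). [cite: Chudnovsky1984, Ch. 7 Thm 4.1 p. 318] -/
def V (t : ℕ) (n : ℕ × ℕ) (l : Lam La L0 L1) : RA :=
  X 3 ^ (n.1 * (l.2.1 : ℕ)) * X 4 ^ (n.2 * (l.2.1 : ℕ)) *
    MvPolynomial.aeval (sval n) (((E₀ l.2.1) ^ t) (X (Sum.inl 0) ^ (l.1 : ℕ) * X (Sum.inl 1) ^ (l.2.2 : ℕ)))

/-- The numbers `x = (ω₁, ω₂, c, e^{cω₁}, e^{cω₂}, e₁, g₂/2)` substituted for `(a₀, …, a₆)`.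
[folklore] -/
def xv : Fin 7 → ℂ := ![L.ω₁, L.ω₂, c, cexp (c * L.ω₁), cexp (c * L.ω₂), e₁ L, L.g₂ / 2]

/-- The specialisation `ℤ[a] → ℂ`, `a ↦ x`. [folklore] -/
abbrev φx : RA →+* ℂ := (MvPolynomial.aeval (xv L c) : RA →ₐ[ℤ] ℂ).toRingHom

/-- `φx` is evaluation at `xv`. [folklore] -/
lemma φx_apply (P : RA) : φx L c P = MvPolynomial.aeval (xv L c) P := rfl

/-- The specialisation of the constants `ℤ[X; a] → ℂ[X]`, `a ↦ x`, `Xᵢ ↦ Xᵢ`. [folklore] -/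
abbrev ψx : RX →ₐ[ℤ] MvPolynomial (Fin 3) ℂ :=
  MvPolynomial.aeval (Sum.elim X fun l => C (xv L c l))

/-- `ψx` intertwines the values of the two derivations on the variables. [folklore] -/
lemma ψx_dval (s' : Fin 3 ⊕ Fin 7) : ψx L c (dval s') = Dℂ L (ψx L c (X s')) := by
  rcases s' with s' | l
  · fin_cases s'
    · simp [dval, tubDVal]
    · simp [dval, tubDVal]
    · simp [dval, xv, tubDVal, map_ofNat]
      ring
  · simp [dval]

/-- **Specialisation commutes with derivation**: `ψx (D₀ Q) = D (ψx Q)`. [folklore] -/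
theorem ψx_D₀ (Q : RX) : ψx L c (D₀ Q) = Dℂ L (ψx L c Q) := by
  induction Q using MvPolynomial.induction_on with
  | C r =>
    rw [D₀, MvPolynomial.derivation_C, map_zero, MvPolynomial.aeval_C, eq_intCast,
      Derivation.map_intCast]
  | add p q hp hq => simp only [map_add, hp, hq]
  | mul_X p s' hp =>
    rw [Derivation.leibniz, smul_eq_mul, smul_eq_mul, map_add, map_mul, map_mul, hp, D₀_X,
      ψx_dval, map_mul, (Dℂ L).leibniz, smul_eq_mul, smul_eq_mul]

/-- `ψx (E_j Q) = E_{jc} (ψx Q)`. [folklore] -/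
theorem ψx_E₀ (j : ℕ) (Q : RX) : ψx L c (E₀ j Q) = Eℂ L ((j : ℂ) * c) (ψx L c Q) := by
  rw [E₀_apply, tubE_apply, map_add, ψx_D₀, map_mul, map_mul]
  congr 1
  have h1 : ψx L c (X (Sum.inr 2) : RX) = C c := by simp [xv]
  have h2 : ψx L c (j : RX) = C (j : ℂ) := by
    rw [map_natCast, map_natCast]
  rw [h1, h2, ← map_mul]

/-- The same for the iterates. [folklore] -/
theorem ψx_E₀_pow (j t : ℕ) (Q : RX) :
    ψx L c (((E₀ j) ^ t) Q) = ((Eℂ L ((j : ℂ) * c)) ^ t) (ψx L c Q) := by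
  induction t generalizing Q with
  | zero => simp
  | succ t ih =>
    rw [pow_succ, pow_succ, Module.End.mul_apply, Module.End.mul_apply, ih]
    exact congrArg _ (ψx_E₀ L c j Q)

/-- Compatibility of the two evaluations at `z_n`:
`φx (Q(n₁a₀+n₂a₁, 0, 0; a)) = (ψx Q)(n₁ω₁+n₂ω₂, 0, 0)`. [folklore] -/
lemma φx_aeval_sval (n : ℕ × ℕ) (Q : RX) :
    φx L c (MvPolynomial.aeval (sval n) Q) = eval ![lvec L n, 0, 0] (ψx L c Q) := by
  change ((φx L c).comp (MvPolynomial.aeval (sval n) : RX →ₐ[ℤ] RA).toRingHom) Q =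
    ((MvPolynomial.eval ![lvec L n, 0, 0]).comp (ψx L c).toRingHom) Q
  congr 1
  refine MvPolynomial.ringHom_ext (fun r => by simp) (fun s' => ?_)
  rcases s' with s' | l
  · fin_cases s'
    · simp [sval, xv, lvec]
    · simp [sval]
    · simp [sval]
  · fin_cases l <;> simp [sval, xv]

/-- Specialising the formal value gives the complex value. [folklore] -/
theorem φx_V (t : ℕ) (n : ℕ × ℕ) (l : Lam La L0 L1) :
    φx L c (V t n l) =
      cexp (c * L.ω₁) ^ (n.1 * (l.2.1 : ℕ)) * cexp (c * L.ω₂) ^ (n.2 * (l.2.1 : ℕ)) *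
        eval ![lvec L n, 0, 0] (((Eℂ L (freq c l)) ^ t) (mono ℂ l.1 l.2.2)) := by
  unfold V
  rw [map_mul, map_mul, map_pow, map_pow, φx_aeval_sval, ψx_E₀_pow]
  have h3 : φx L c (X 3 : RA) = cexp (c * L.ω₁) := by simp [φx, xv]
  have h4 : φx L c (X 4 : RA) = cexp (c * L.ω₂) := by simp [φx, xv]
  rw [h3, h4]
  congr 2
  simp [map_mul, map_pow, freq]

/-- **Value formula.** `F_p^{(t)}(z_n) = ∑ p_l · φx (V t n l)`: the derivatives of the
auxiliary function at the points `z_n` are the specialisations at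
`(ω₁, ω₂, c, e^{cω₁}, e^{cω₂}, e₁, g₂/2)` of fixed integer polynomials.
[cite: Chudnovsky1984, Ch. 7 Thm 4.1 p. 318] -/
theorem iteratedDeriv_F_zpt (p : Lam La L0 L1 → ℂ) (t : ℕ) (n : ℕ × ℕ) :
    iteratedDeriv t (F L c p) (zpt L n) = ∑ l, p l * φx L c (V t n l) := by
  rw [iteratedDeriv_F_zpt_eq_sum]
  simp_rw [φx_V]

end Literature.NumberTheory.Transcendental.TubbsPeriods

end
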